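import Literature.NumberTheory.LFunctions.Zhang2022.ObjectiveTwinEllFrame

/-!
# Zhang (2022) design-space objective, twin part 12: the frame change acts on the TWISTS too —
# `rescale r (ϰ_{ν,k}) = ϰ_{rν, k/r}`, and the faithful reflection-frame design `thetaFrame`

Y. Zhang, *Discrete mean estimates and the Landau–Siegel zero*, arXiv:2211.02515v1 (2022)
[Zhang2022LandauSiegel] — an unrefereed manuscript under adjudication. **This file SEARCHES and TYPES; it
makes no claim about Landau–Siegel zeros, about Theorems 1–2 of the manuscript, or about a repaired (2.32),
until a kernel theorem says so.** LANDAU–SIEGEL programme, cell `landau-siegel`, §A Lean twin; companion of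
`ObjectiveTwinEllFrame` (scaling law) and of `EllRegimeStatements` (`EllRegime.thetaRefl`, the reflection-frame
design «every `L_M`-length × `L_M/L_R`; shifts `k` and coefficients `ι` unchanged»).

The mollifier coefficient of one `ϰ`-component is a FIXED function of `n`: `(1 − z/ν)(P^ν/n)^{ikα} =
(1 − z/ν)e^{iπk(ν−z)}`, `z = log n/log P` (`α = π/log P`, (2.10), (2.23)–(2.25)). In the reflection frame
`y = log n/L_R = r·z` (`r = L_M/L_R = Scales.shrink`) the same sequence reads `(1 − y/(rν))e^{iπ(k/r)(rν − y)}`: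
the length becomes `rν` AND the twist per frame unit becomes `k/r`. Kernel form (`Repair.kappaP`):

  `rescale r (kappaP ν k) = kappaP (r·ν) (k/r)`,  `rescale' r (kappaP' ν k) = kappaP' (r·ν) (k/r)`  (`0 < r`),

hence for the pair profiles and the two sides of a design `θ : Repair.Theta`
(`h1Profile/h2Profile_thetaFrame`): the FAITHFUL reflection-frame design is `thetaFrame r θ` = (lengths `× r`,
twists `/ r`, `ι` unchanged, `cut₁ × r`), and `gluedS (thetaFrame r θ) = rescale r h₁ + R̃(rescale r h₂)`
(`gluedS_thetaFrame`; the reflection `R̃` acts at `y = 1` of the frame, so the glued profile is NOT a rescale of the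
physical-frame glued profile — only its one-sided constituents are). `EllRegime.thetaRefl S θ` keeps the
twists: it is `thetaFrame` of the design with twists `k_j·(L_M/L_R)` (`thetaFrame_shrink_eq_thetaRefl_retwisted`),
i.e. a detuning of every twist by the relative amount `1 − L_M/L_R ≈ (1+τ₀/2)/A` — the same order as `ε` and as
the support shrink. CLASS-level statements (sup/emptiness over designs with `k` free) are invariant under this
re-parametrisation; PER-DESIGN first-order tables at printed `k` are not (they differ by `−(1−r)·Σ k_j∂_{k_j}` at
order `1/A`). This file only records the identities; which parametrisation a row of record uses is the planner's /
ls-theory's call. One plumbing definition (`thetaFrame`); theorems otherwise.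
-/

noncomputable section

open Real Complex ComplexConjugate

namespace Literature.NumberTheory.LFunctions.Zhang2022

namespace EllRegime

open Repair EllScales

/-! ## One `ϰ`-component: support `× r`, twist `/ r` -/

/-- **`rescale r ϰ_{ν,k} = ϰ_{rν,k/r}`** (`0 < r`): re-reading a `ϰ`-component in a frame whose unit is `1/r` times
the mollifier unit multiplies its length by `r` and DIVIDES its twist by `r` (the phase `e^{iπk(ν − y/r)} =
e^{iπ(k/r)(rν − y)}`). [cite: Zhang2022LandauSiegel, §2 (2.10), (2.23)–(2.25), (2.30)] -/
theorem rescale_kappaP {r : ℝ} (hr : 0 < r) (ν k : ℝ) :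
    rescale r (kappaP ν k) = kappaP (r * ν) (k / r) := by
  funext y
  simp only [rescale, kappaP]
  have hiff : y / r ≤ ν ↔ y ≤ r * ν := by rw [div_le_iff₀ hr, mul_comm]
  by_cases h : y ≤ r * ν
  · rw [if_pos (hiff.mpr h), if_pos h]
    have hr' : (r : ℂ) ≠ 0 := Complex.ofReal_ne_zero.mpr hr.ne'
    have e1 : ((1 - y / r / ν : ℝ) : ℂ) = ((1 - y / (r * ν) : ℝ) : ℂ) := by
      rw [div_div, mul_comm]
    have e2 : (k : ℂ) * π * I * ((ν - y / r : ℝ) : ℂ) = ((k / r : ℝ) : ℂ) * π * I * ((r * ν - y : ℝ) : ℂ) := by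
      push_cast
      field_simp
    rw [e1, e2]
  · rw [if_neg (fun h' => h (hiff.mp h')), if_neg h]

/-- The derivative companions agree: `rescale′ r ϰ′_{ν,k} = ϰ′_{rν,k/r}` (`0 < r`).
[cite: Zhang2022LandauSiegel, §2 (2.10), (2.23)–(2.25), (2.30)] -/
theorem rescale'_kappaP' {r : ℝ} (hr : 0 < r) (ν k : ℝ) :
    rescale' r (kappaP' ν k) = kappaP' (r * ν) (k / r) := by
  funext y
  simp only [rescale', kappaP']
  have hiff : y / r < ν ↔ y < r * ν := by rw [div_lt_iff₀ hr, mul_comm]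
  by_cases h : y < r * ν
  · rw [if_pos (hiff.mpr h), if_pos h]
    have hr' : (r : ℂ) ≠ 0 := Complex.ofReal_ne_zero.mpr hr.ne'
    have e2 : (k : ℂ) * π * I * ((ν - y / r : ℝ) : ℂ) = ((k / r : ℝ) : ℂ) * π * I * ((r * ν - y : ℝ) : ℂ) := by
      push_cast
      field_simp
    rw [e2]
    push_cast
    field_simp
  · rw [if_neg (fun h' => h (hiff.mp h')), if_neg h, mul_zero]

/-- Pair profiles: `rescale r (u_L ϰ_{ν_L,k_L} + u_S ϰ_{ν_S,k_S}) = u_L ϰ_{rν_L,k_L/r} + u_S ϰ_{rν_S,k_S/r}`.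
[cite: Zhang2022LandauSiegel, §2 (2.23)–(2.27)] -/
theorem rescale_pairProfile {r : ℝ} (hr : 0 < r) (νL kL νS kS : ℝ) (uL uS : ℂ) :
    rescale r (pairProfile νL kL νS kS uL uS) = pairProfile (r * νL) (kL / r) (r * νS) (kS / r) uL uS := by
  funext y
  have h1 := congrFun (rescale_kappaP hr νL kL) y
  have h2 := congrFun (rescale_kappaP hr νS kS) y
  simp only [rescale] at h1 h2 ⊢
  simp only [pairProfile, h1, h2]

/-- Derivative companions of pair profiles. [cite: Zhang2022LandauSiegel, §2 (2.23)–(2.27)] -/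
theorem rescale'_pairProfile' {r : ℝ} (hr : 0 < r) (νL kL νS kS : ℝ) (uL uS : ℂ) :
    rescale' r (pairProfile' νL kL νS kS uL uS) = pairProfile' (r * νL) (kL / r) (r * νS) (kS / r) uL uS := by
  funext y
  have h1 := congrFun (rescale'_kappaP' hr νL kL) y
  have h2 := congrFun (rescale'_kappaP' hr νS kS) y
  simp only [rescale'] at h1 h2 ⊢
  simp only [pairProfile', ← h1, ← h2]
  ring

/-! ## The faithful reflection-frame design -/

/-- **The design read in a frame of unit `1/r` times the mollifier unit**: lengths `× r`, twists `/ r`,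
coefficients `ι` unchanged, `cut₁ × r`. With `r = L_M/L_R` this is the FAITHFUL reflection-frame design (each
one-sided constituent is `rescale r` of the physical one). [cite: Zhang2022LandauSiegel, §2 (2.10), (2.21)–(2.27), (2.30)] -/
def thetaFrame (r : ℝ) (θ : Theta) : Theta :=
  { θ with
    nu1 := r * θ.nu1
    nu2 := r * θ.nu2
    nu3 := r * θ.nu3
    k1 := θ.k1 / r
    k2 := θ.k2 / r
    k3 := θ.k3 / r
    cut1 := r * θ.cut1 }

/-- Side 1: `h1Profile (thetaFrame r θ) = rescale r (h1Profile θ)`. [cite: Zhang2022LandauSiegel, §2 (2.23), (2.24), (2.27)] -/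
theorem h1Profile_thetaFrame {r : ℝ} (hr : 0 < r) (θ : Theta) :
    h1Profile (thetaFrame r θ) = rescale r (h1Profile θ) := by
  unfold h1Profile
  rw [rescale_pairProfile hr]
  rfl

/-- Side 1, derivative companion. [cite: Zhang2022LandauSiegel, §2 (2.23), (2.24), (2.27)] -/
theorem h1Profile'_thetaFrame {r : ℝ} (hr : 0 < r) (θ : Theta) :
    h1Profile' (thetaFrame r θ) = rescale' r (h1Profile' θ) := by
  unfold h1Profile'
  rw [rescale'_pairProfile' hr]
  rfl

/-- Side 2: `h2Profile (thetaFrame r θ) = rescale r (h2Profile θ)`. [cite: Zhang2022LandauSiegel, §2 (2.24), (2.25), (2.27)] -/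
theorem h2Profile_thetaFrame {r : ℝ} (hr : 0 < r) (θ : Theta) :
    h2Profile (thetaFrame r θ) = rescale r (h2Profile θ) := by
  unfold h2Profile
  rw [rescale_pairProfile hr]
  rfl

/-- Side 2, derivative companion. [cite: Zhang2022LandauSiegel, §2 (2.24), (2.25), (2.27)] -/
theorem h2Profile'_thetaFrame {r : ℝ} (hr : 0 < r) (θ : Theta) :
    h2Profile' (thetaFrame r θ) = rescale' r (h2Profile' θ) := by
  unfold h2Profile'
  rw [rescale'_pairProfile' hr]
  rfl

/-- **The glued profile of the faithful frame design**: `gluedS (thetaFrame r θ) = rescale r h₁ + R̃(rescale r h₂)`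
— the reflection acts at `y = 1` of the frame on the rescaled side-2 profile (so the glued profile is not itself a
rescale of the physical-frame glued profile). [cite: Zhang2022LandauSiegel, §2 (2.27), (2.32); §12 (12.6)–(12.8)] -/
theorem gluedS_thetaFrame {r : ℝ} (hr : 0 < r) (θ : Theta) :
    gluedS (thetaFrame r θ) = fun y => rescale r (h1Profile θ) y + reflProfile (rescale r (h2Profile θ)) y := by
  unfold gluedS
  rw [h1Profile_thetaFrame hr, h2Profile_thetaFrame hr]

/-- The glued derivative companion likewise. [cite: Zhang2022LandauSiegel, §2 (2.27), (2.32); §12 (12.6)–(12.8)] -/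
theorem gluedS'_thetaFrame {r : ℝ} (hr : 0 < r) (θ : Theta) :
    gluedS' (thetaFrame r θ) =
      fun y => rescale' r (h1Profile' θ) y + reflDeriv (rescale' r (h2Profile' θ)) y := by
  unfold gluedS'
  rw [h1Profile'_thetaFrame hr, h2Profile'_thetaFrame hr]

/-- **`thetaRefl` versus the faithful frame design.** `EllRegime.thetaRefl S θ` (lengths of the physical design
`thetaPhys S θ` times `L_M/L_R`, twists unchanged) is `thetaFrame (L_M/L_R)` of the physical design with every
twist multiplied by `L_M/L_R` first: the two parametrisations of the reflection-frame design differ exactly by the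
re-twist `k_j ↦ k_j·(L_M/L_R)` (relative detuning `1 − L_M/L_R`, of order `1/A`). [cite: Zhang2022LandauSiegel, §2 (2.10), (2.21)–(2.27), (2.30)] -/
theorem thetaFrame_shrink_eq_thetaRefl_retwisted (S : Scales) (hS : S.shrink ≠ 0) (θ : Theta) :
    thetaFrame S.shrink
        { thetaPhys S θ with k1 := θ.k1 * S.shrink, k2 := θ.k2 * S.shrink, k3 := θ.k3 * S.shrink } =
      thetaRefl S θ := by
  simp only [thetaFrame, thetaRefl, thetaPhys, mul_div_cancel_right₀ _ hS]

/-- Conversely, the faithful frame design of the physical design is `thetaRefl` with every twist DIVIDED by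
`L_M/L_R`. [cite: Zhang2022LandauSiegel, §2 (2.10), (2.21)–(2.27), (2.30)] -/
theorem thetaFrame_thetaPhys_eq (S : Scales) (θ : Theta) :
    thetaFrame S.shrink (thetaPhys S θ) =
      { thetaRefl S θ with k1 := θ.k1 / S.shrink, k2 := θ.k2 / S.shrink, k3 := θ.k3 / S.shrink } := by
  simp only [thetaFrame, thetaRefl, thetaPhys]

end EllRegime

end Literature.NumberTheory.LFunctions.Zhang2022
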